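import Summits.CriticalPhenomena.PercolationContinuityZ3.Theorems.PercNearOneGluingNoHeavyQuantLightTwoBlobFlow
import Summits.CriticalPhenomena.PercolationContinuityZ3.Theorems.PercNearOneGluingNoHeavyQuantLightTwoBlobPolyCoef
import Summits.CriticalPhenomena.PercolationContinuityZ3.Theorems.PercNearOneGluingNoHeavyQuantLightTwoBlobPolyA
import HarnessLib

/-!
# QUANT lane R8, T-DEC: the light two-blob law, sub-cases "a low" / "b low" — part 3a: the TOP INEQUALITY in the five cells of sub-case "a low" (A1–A5)

builds on p205010 (kernel theorem, internal audit signed; external expert review pending)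

Support file (`--supports stmt-CriticalPhenomena-4575`), QUANT lane typer seat prim-quant-stmt (gen 23), rung R8 of
`run/shared/lean/prim/quant/LADDER.md`.  Theorems only, standard axioms, no sorries.

With `κ = (γ − x²)/(1 − x)` and `T = bκ + ag`, sub-case "a low" is `2a < T` (then `a < b`); the law is read as `LAW2[a, g; b, γ]`
(`law2_swap`).  Certificate (I\*) ships `a ↦ a+b` at its (always light) minimal credit gate and atom `0 ↦ b` to capacity `F` (light gate:
`F = (1−g)γ(1−x)((1+x)b − T)/(x²b + (1−x)T)` when `T ≤ xb`; heavy: `F = (1−g)γ(b−T)/T` when `xb ≤ T < b`; `F = 0` when `b ≤ T`), the rest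
`↦ a+b`.  Lemmas `top_A1` … `top_A5` prove the top inequality `usage(a,a+b)·g(1−γ) + usage(0,a+b)·((1−g)(1−γ) − F) ≤ gγ` cell by cell
from the polynomial certificates `LightTwoBlobCert.poly_A1 … poly_A5` of `…QuantLightTwoBlobPolyCoef` / `…PolyA` (cells A2/A3 use the
implied condition `x(2−g) ≤ 2κ`).

[this work]; DEC rules ARCH-TREES-G49 §2.2 / DEC-TAMP-G50 §3.1, flow normal form `…QuantLawDecFlows` (this lane).  The gluing rows served
[cite: KozmaNitzan2024, Conjecture 3 (p. 15)]; product measure [cite: Grimmett1999, §1.3 p. 10].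
-/

noncomputable section

namespace Summit.CriticalPhenomena.PercolationContinuityZ3.Theorems

namespace Quant

open Finset

/-- the two-blob law `(1−u)(1−v)δ₀ + u(1−v)δ_a + (1−u)vδ_b + uvδ_{a+b}` evaluated at `h` (as in `…QuantBlobDecTwoLawParts`) -/
local notation3 "LAW2[" a ", " u ", " b ", " v ", " h "]" =>
  (1 - (u : ℝ)) * (1 - (v : ℝ)) * (if (h : ℕ) = 0 then (1 : ℝ) else 0)
    + (u : ℝ) * (1 - (v : ℝ)) * (if (h : ℕ) = (a : ℕ) then (1 : ℝ) else 0)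
    + (1 - (u : ℝ)) * (v : ℝ) * (if (h : ℕ) = (b : ℕ) then (1 : ℝ) else 0)
    + (u : ℝ) * (v : ℝ) * (if (h : ℕ) = (a : ℕ) + (b : ℕ) then (1 : ℝ) else 0)

namespace LawDec

/-- **top inequality, cell A1** (c<bx: (0,b) light, (0,s) light). [this work] -/
theorem top_A1 (x κ g : ℝ) (a b j'' : ℕ) (hx0 : 0 < x) (hx1 : x < 1) (hk0 : 0 < κ) (hkx : κ < x) (hxg : x ≤ g)
    (hg1 : g ≤ 1) (ha : 1 ≤ a) (hb : 1 ≤ b) (hj : a + b ≤ j'') (h2a : 2 * (a : ℝ) < (b : ℝ) * κ + (a : ℝ) * g)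
    (hTbx : ((b : ℝ) * κ + (a : ℝ) * g) ≤ x * (b : ℝ)) (hL0 : ((b : ℝ) * κ + (a : ℝ) * g) ≤ x * ((a + b : ℕ) : ℝ)) :
    usage x ((b : ℝ) * κ + (a : ℝ) * g) j'' a (a + b) * (g * (1 - (x ^ 2 + (1 - x) * κ)))
      + usage x ((b : ℝ) * κ + (a : ℝ) * g) j'' 0 (a + b) * ((1 - g) * (1 - (x ^ 2 + (1 - x) * κ)) - (1 - g) * (x ^ 2 + (1 - x) * κ) * ((1 - x) * ((1 + x) * (b : ℝ) - ((b : ℝ) * κ + (a : ℝ) * g))) / (x ^ 2 * (b : ℝ) + (1 - x) * ((b : ℝ) * κ + (a : ℝ) * g)))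
      ≤ g * (x ^ 2 + (1 - x) * κ) := by
  have ha0 : (0 : ℝ) < (a : ℝ) := by exact_mod_cast Nat.lt_of_lt_of_le Nat.zero_lt_one ha
  have hb0 : (0 : ℝ) < (b : ℝ) := by exact_mod_cast Nat.lt_of_lt_of_le Nat.zero_lt_one hb
  have hg0 : 0 < g := lt_of_lt_of_le hx0 hxg
  have hgam : 0 < x ^ 2 + (1 - x) * κ := by nlinarith [mul_pos (sub_pos.2 hx1) hk0, pow_pos hx0 2]
  have hgam1 : x ^ 2 + (1 - x) * κ < 1 := by nlinarith [mul_lt_mul_of_pos_left hkx (sub_pos.2 hx1)]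
  have hT0 : 0 < (b : ℝ) * κ + (a : ℝ) * g := by nlinarith [mul_pos hb0 hk0, mul_pos ha0 hg0]
  have hsT : (b : ℝ) * κ + (a : ℝ) * g < (b : ℝ) + (a : ℝ) := by
    nlinarith [mul_pos hb0 (sub_pos.2 (hkx.trans hx1)), mul_nonneg ha0.le (sub_nonneg.2 hg1)]
  have hL1n : (b : ℝ) * κ + (a : ℝ) * g - 2 * (a : ℝ) ≤ x * (b : ℝ) := by
    nlinarith [mul_le_mul_of_nonneg_left hkx.le hb0.le, mul_nonneg ha0.le (by linarith : (0:ℝ) ≤ 2 - g)]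
  have hL1 : (b : ℝ) * κ + (a : ℝ) * g - 2 * (a : ℝ) ≤ x * (((a + b : ℕ) : ℝ) - (a : ℝ)) := by push_cast; linarith
  have hL0n : (b : ℝ) * κ + (a : ℝ) * g ≤ x * ((a : ℝ) + (b : ℝ)) := by have h' := hL0; push_cast at h'; linarith
  rw [usage_eq_light' x _ j'' a (a + b) hx0 hx1 hj h2a (by push_cast; linarith) hL1,
    usage0_eq_light x _ j'' (a + b) hx0 hx1 hj hT0 (by push_cast; linarith) hL0]
  push_cast
  have hd1 : (0:ℝ) < (1 - x) * ((1 - x) * (a : ℝ) + (1 + x) * ((a : ℝ) + (b : ℝ)) - ((b : ℝ) * κ + (a : ℝ) * g)) := by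
    apply mul_pos (sub_pos.2 hx1); nlinarith [mul_nonneg hx0.le (by linarith : (0:ℝ) ≤ (a : ℝ) + (b : ℝ))]
  have hd0 : (0:ℝ) < (1 - x) * ((1 + x) * ((a : ℝ) + (b : ℝ)) - ((b : ℝ) * κ + (a : ℝ) * g)) := by
    apply mul_pos (sub_pos.2 hx1); nlinarith [mul_nonneg hx0.le (by linarith : (0:ℝ) ≤ (a : ℝ) + (b : ℝ))]
  have hn1 : (0:ℝ) ≤ x ^ 2 * (b : ℝ) + (1 - x) * ((b : ℝ) * κ + (a : ℝ) * g - 2 * (a : ℝ)) := by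
    nlinarith [mul_nonneg (pow_nonneg hx0.le 2) hb0.le, mul_nonneg (sub_nonneg.2 hx1.le) (sub_nonneg.2 h2a.le)]
  have hFd : (0:ℝ) < x ^ 2 * (b : ℝ) + (1 - x) * ((b : ℝ) * κ + (a : ℝ) * g) := by nlinarith [mul_pos (pow_pos hx0 2) hb0]
  have key := LightTwoBlobCert.poly_A1 x κ g a b ha0.le hb0.le (by linarith) (by linarith) (by linarith [hgam.le]) (by linarith) (by linarith) (by linarith) hk0.le hx0.le
  rw [div_mul_eq_mul_div, sub_div' hFd.ne', div_mul_div_comm, div_add_div _ _ hd1.ne' (mul_ne_zero hd0.ne' hFd.ne'),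
    div_le_iff₀ (mul_pos hd1 (mul_pos hd0 hFd))]
  linarith [mul_nonneg (sub_nonneg.2 hx1.le) (mul_nonneg (sub_nonneg.2 hx1.le) (mul_nonneg hg0.le (mul_nonneg ha0.le (key))))]

/-- **top inequality, cell A2** (bx<=c<b: (0,b) heavy, (0,s) light). [this work] -/
theorem top_A2 (x κ g : ℝ) (a b j'' : ℕ) (hx0 : 0 < x) (hx1 : x < 1) (hk0 : 0 < κ) (hkx : κ < x) (hxg : x ≤ g)
    (hg1 : g ≤ 1) (ha : 1 ≤ a) (hb : 1 ≤ b) (hj : a + b ≤ j'') (h2a : 2 * (a : ℝ) < (b : ℝ) * κ + (a : ℝ) * g)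
    (hbx : x * (b : ℝ) ≤ ((b : ℝ) * κ + (a : ℝ) * g)) (hTb : ((b : ℝ) * κ + (a : ℝ) * g) < (b : ℝ)) (hL0 : ((b : ℝ) * κ + (a : ℝ) * g) ≤ x * ((a + b : ℕ) : ℝ)) :
    usage x ((b : ℝ) * κ + (a : ℝ) * g) j'' a (a + b) * (g * (1 - (x ^ 2 + (1 - x) * κ)))
      + usage x ((b : ℝ) * κ + (a : ℝ) * g) j'' 0 (a + b) * ((1 - g) * (1 - (x ^ 2 + (1 - x) * κ)) - (1 - g) * (x ^ 2 + (1 - x) * κ) * ((b : ℝ) - ((b : ℝ) * κ + (a : ℝ) * g)) / ((b : ℝ) * κ + (a : ℝ) * g))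
      ≤ g * (x ^ 2 + (1 - x) * κ) := by
  have ha0 : (0 : ℝ) < (a : ℝ) := by exact_mod_cast Nat.lt_of_lt_of_le Nat.zero_lt_one ha
  have hb0 : (0 : ℝ) < (b : ℝ) := by exact_mod_cast Nat.lt_of_lt_of_le Nat.zero_lt_one hb
  have hg0 : 0 < g := lt_of_lt_of_le hx0 hxg
  have hgam : 0 < x ^ 2 + (1 - x) * κ := by nlinarith [mul_pos (sub_pos.2 hx1) hk0, pow_pos hx0 2]
  have hgam1 : x ^ 2 + (1 - x) * κ < 1 := by nlinarith [mul_lt_mul_of_pos_left hkx (sub_pos.2 hx1)]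
  have hT0 : 0 < (b : ℝ) * κ + (a : ℝ) * g := by nlinarith [mul_pos hb0 hk0, mul_pos ha0 hg0]
  have hsT : (b : ℝ) * κ + (a : ℝ) * g < (b : ℝ) + (a : ℝ) := by
    nlinarith [mul_pos hb0 (sub_pos.2 (hkx.trans hx1)), mul_nonneg ha0.le (sub_nonneg.2 hg1)]
  have hL1n : (b : ℝ) * κ + (a : ℝ) * g - 2 * (a : ℝ) ≤ x * (b : ℝ) := by
    nlinarith [mul_le_mul_of_nonneg_left hkx.le hb0.le, mul_nonneg ha0.le (by linarith : (0:ℝ) ≤ 2 - g)]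
  have hL1 : (b : ℝ) * κ + (a : ℝ) * g - 2 * (a : ℝ) ≤ x * (((a + b : ℕ) : ℝ) - (a : ℝ)) := by push_cast; linarith
  have hL0n : (b : ℝ) * κ + (a : ℝ) * g ≤ x * ((a : ℝ) + (b : ℝ)) := by have h' := hL0; push_cast at h'; linarith
  have himpl : 0 ≤ 2 * κ - 2 * x + x * g := by
    have P1 : x * (b : ℝ) * (2 - g) ≤ ((b : ℝ) * κ + (a : ℝ) * g) * (2 - g) := mul_le_mul_of_nonneg_right hbx (by linarith)
    have P2 : g * ((a : ℝ) * (2 - g)) ≤ g * ((b : ℝ) * κ) := mul_le_mul_of_nonneg_left (by nlinarith) hg0.le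
    nlinarith [P1, P2, hb0]
  rw [usage_eq_light' x _ j'' a (a + b) hx0 hx1 hj h2a (by push_cast; linarith) hL1,
    usage0_eq_light x _ j'' (a + b) hx0 hx1 hj hT0 (by push_cast; linarith) hL0]
  push_cast
  have hd1 : (0:ℝ) < (1 - x) * ((1 - x) * (a : ℝ) + (1 + x) * ((a : ℝ) + (b : ℝ)) - ((b : ℝ) * κ + (a : ℝ) * g)) := by
    apply mul_pos (sub_pos.2 hx1); nlinarith [mul_nonneg hx0.le (by linarith : (0:ℝ) ≤ (a : ℝ) + (b : ℝ))]
  have hd0 : (0:ℝ) < (1 - x) * ((1 + x) * ((a : ℝ) + (b : ℝ)) - ((b : ℝ) * κ + (a : ℝ) * g)) := by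
    apply mul_pos (sub_pos.2 hx1); nlinarith [mul_nonneg hx0.le (by linarith : (0:ℝ) ≤ (a : ℝ) + (b : ℝ))]
  have hn1 : (0:ℝ) ≤ x ^ 2 * (b : ℝ) + (1 - x) * ((b : ℝ) * κ + (a : ℝ) * g - 2 * (a : ℝ)) := by
    nlinarith [mul_nonneg (pow_nonneg hx0.le 2) hb0.le, mul_nonneg (sub_nonneg.2 hx1.le) (sub_nonneg.2 h2a.le)]
  have key := LightTwoBlobCert.poly_A2 x κ g a b ha0.le hb0.le (by linarith) (by linarith) (by linarith [hgam.le]) (by linarith) (by linarith) (by linarith) (by linarith [himpl]) hk0.le hx0.le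
  rw [div_mul_eq_mul_div, sub_div' hT0.ne', div_mul_div_comm, div_add_div _ _ hd1.ne' (mul_ne_zero hd0.ne' hT0.ne'),
    div_le_iff₀ (mul_pos hd1 (mul_pos hd0 hT0))]
  linarith [mul_nonneg (sub_nonneg.2 hx1.le) (key)]

/-- **top inequality, cell A3** (bx<=c<b: (0,b) heavy, (0,s) heavy). [this work] -/
theorem top_A3 (x κ g : ℝ) (a b j'' : ℕ) (hx0 : 0 < x) (hx1 : x < 1) (hk0 : 0 < κ) (hkx : κ < x) (hxg : x ≤ g)
    (hg1 : g ≤ 1) (ha : 1 ≤ a) (hb : 1 ≤ b) (hj : a + b ≤ j'') (h2a : 2 * (a : ℝ) < (b : ℝ) * κ + (a : ℝ) * g)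
    (hbx : x * (b : ℝ) ≤ ((b : ℝ) * κ + (a : ℝ) * g)) (hTb : ((b : ℝ) * κ + (a : ℝ) * g) < (b : ℝ)) (hH0 : x * ((a + b : ℕ) : ℝ) ≤ ((b : ℝ) * κ + (a : ℝ) * g)) :
    usage x ((b : ℝ) * κ + (a : ℝ) * g) j'' a (a + b) * (g * (1 - (x ^ 2 + (1 - x) * κ)))
      + usage x ((b : ℝ) * κ + (a : ℝ) * g) j'' 0 (a + b) * ((1 - g) * (1 - (x ^ 2 + (1 - x) * κ)) - (1 - g) * (x ^ 2 + (1 - x) * κ) * ((b : ℝ) - ((b : ℝ) * κ + (a : ℝ) * g)) / ((b : ℝ) * κ + (a : ℝ) * g))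
      ≤ g * (x ^ 2 + (1 - x) * κ) := by
  have ha0 : (0 : ℝ) < (a : ℝ) := by exact_mod_cast Nat.lt_of_lt_of_le Nat.zero_lt_one ha
  have hb0 : (0 : ℝ) < (b : ℝ) := by exact_mod_cast Nat.lt_of_lt_of_le Nat.zero_lt_one hb
  have hg0 : 0 < g := lt_of_lt_of_le hx0 hxg
  have hgam : 0 < x ^ 2 + (1 - x) * κ := by nlinarith [mul_pos (sub_pos.2 hx1) hk0, pow_pos hx0 2]
  have hgam1 : x ^ 2 + (1 - x) * κ < 1 := by nlinarith [mul_lt_mul_of_pos_left hkx (sub_pos.2 hx1)]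
  have hT0 : 0 < (b : ℝ) * κ + (a : ℝ) * g := by nlinarith [mul_pos hb0 hk0, mul_pos ha0 hg0]
  have hsT : (b : ℝ) * κ + (a : ℝ) * g < (b : ℝ) + (a : ℝ) := by
    nlinarith [mul_pos hb0 (sub_pos.2 (hkx.trans hx1)), mul_nonneg ha0.le (sub_nonneg.2 hg1)]
  have hL1n : (b : ℝ) * κ + (a : ℝ) * g - 2 * (a : ℝ) ≤ x * (b : ℝ) := by
    nlinarith [mul_le_mul_of_nonneg_left hkx.le hb0.le, mul_nonneg ha0.le (by linarith : (0:ℝ) ≤ 2 - g)]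
  have hL1 : (b : ℝ) * κ + (a : ℝ) * g - 2 * (a : ℝ) ≤ x * (((a + b : ℕ) : ℝ) - (a : ℝ)) := by push_cast; linarith
  have hH0n : x * ((a : ℝ) + (b : ℝ)) ≤ (b : ℝ) * κ + (a : ℝ) * g := by have h' := hH0; push_cast at h'; linarith
  have himpl : 0 ≤ 2 * κ - 2 * x + x * g := by
    have P1 : x * (b : ℝ) * (2 - g) ≤ ((b : ℝ) * κ + (a : ℝ) * g) * (2 - g) := mul_le_mul_of_nonneg_right hbx (by linarith)
    have P2 : g * ((a : ℝ) * (2 - g)) ≤ g * ((b : ℝ) * κ) := mul_le_mul_of_nonneg_left (by nlinarith) hg0.le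
    nlinarith [P1, P2, hb0]
  rw [usage_eq_light' x _ j'' a (a + b) hx0 hx1 hj h2a (by push_cast; linarith) hL1,
    usage0_eq_heavy x _ j'' (a + b) hx0 hx1 hj hT0 (by push_cast; linarith) hH0]
  push_cast
  have hd1 : (0:ℝ) < (1 - x) * ((1 - x) * (a : ℝ) + (1 + x) * ((a : ℝ) + (b : ℝ)) - ((b : ℝ) * κ + (a : ℝ) * g)) := by
    apply mul_pos (sub_pos.2 hx1); nlinarith [mul_nonneg hx0.le (by linarith : (0:ℝ) ≤ (a : ℝ) + (b : ℝ))]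
  have hd0 : (0:ℝ) < ((a : ℝ) + (b : ℝ)) - ((b : ℝ) * κ + (a : ℝ) * g) := by linarith
  have hn1 : (0:ℝ) ≤ x ^ 2 * (b : ℝ) + (1 - x) * ((b : ℝ) * κ + (a : ℝ) * g - 2 * (a : ℝ)) := by
    nlinarith [mul_nonneg (pow_nonneg hx0.le 2) hb0.le, mul_nonneg (sub_nonneg.2 hx1.le) (sub_nonneg.2 h2a.le)]
  have key := LightTwoBlobCert.poly_A3 x κ g a b ha0.le hb0.le (by linarith) (by linarith) (by linarith [hgam.le]) (by linarith) (by linarith) (by linarith) (by linarith [himpl]) hk0.le hx0.le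
  rw [div_mul_eq_mul_div, sub_div' hT0.ne', div_mul_div_comm, div_add_div _ _ hd1.ne' (mul_ne_zero hd0.ne' hT0.ne'),
    div_le_iff₀ (mul_pos hd1 (mul_pos hd0 hT0))]
  linarith [mul_nonneg (sub_nonneg.2 hx1.le) (mul_nonneg hb0.le (mul_nonneg hT0.le (key)))]

/-- **top inequality, cell A4** (c>=b, (0,s) light). [this work] -/
theorem top_A4 (x κ g : ℝ) (a b j'' : ℕ) (hx0 : 0 < x) (hx1 : x < 1) (hk0 : 0 < κ) (hkx : κ < x) (hxg : x ≤ g)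
    (hg1 : g ≤ 1) (ha : 1 ≤ a) (hb : 1 ≤ b) (hj : a + b ≤ j'') (h2a : 2 * (a : ℝ) < (b : ℝ) * κ + (a : ℝ) * g)
    (hTb : (b : ℝ) ≤ ((b : ℝ) * κ + (a : ℝ) * g)) (hL0 : ((b : ℝ) * κ + (a : ℝ) * g) ≤ x * ((a + b : ℕ) : ℝ)) :
    usage x ((b : ℝ) * κ + (a : ℝ) * g) j'' a (a + b) * (g * (1 - (x ^ 2 + (1 - x) * κ)))
      + usage x ((b : ℝ) * κ + (a : ℝ) * g) j'' 0 (a + b) * ((1 - g) * (1 - (x ^ 2 + (1 - x) * κ)) - 0)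
      ≤ g * (x ^ 2 + (1 - x) * κ) := by
  have ha0 : (0 : ℝ) < (a : ℝ) := by exact_mod_cast Nat.lt_of_lt_of_le Nat.zero_lt_one ha
  have hb0 : (0 : ℝ) < (b : ℝ) := by exact_mod_cast Nat.lt_of_lt_of_le Nat.zero_lt_one hb
  have hg0 : 0 < g := lt_of_lt_of_le hx0 hxg
  have hgam : 0 < x ^ 2 + (1 - x) * κ := by nlinarith [mul_pos (sub_pos.2 hx1) hk0, pow_pos hx0 2]
  have hgam1 : x ^ 2 + (1 - x) * κ < 1 := by nlinarith [mul_lt_mul_of_pos_left hkx (sub_pos.2 hx1)]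
  have hT0 : 0 < (b : ℝ) * κ + (a : ℝ) * g := by nlinarith [mul_pos hb0 hk0, mul_pos ha0 hg0]
  have hsT : (b : ℝ) * κ + (a : ℝ) * g < (b : ℝ) + (a : ℝ) := by
    nlinarith [mul_pos hb0 (sub_pos.2 (hkx.trans hx1)), mul_nonneg ha0.le (sub_nonneg.2 hg1)]
  have hL1n : (b : ℝ) * κ + (a : ℝ) * g - 2 * (a : ℝ) ≤ x * (b : ℝ) := by
    nlinarith [mul_le_mul_of_nonneg_left hkx.le hb0.le, mul_nonneg ha0.le (by linarith : (0:ℝ) ≤ 2 - g)]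
  have hL1 : (b : ℝ) * κ + (a : ℝ) * g - 2 * (a : ℝ) ≤ x * (((a + b : ℕ) : ℝ) - (a : ℝ)) := by push_cast; linarith
  have hL0n : (b : ℝ) * κ + (a : ℝ) * g ≤ x * ((a : ℝ) + (b : ℝ)) := by have h' := hL0; push_cast at h'; linarith
  rw [usage_eq_light' x _ j'' a (a + b) hx0 hx1 hj h2a (by push_cast; linarith) hL1,
    usage0_eq_light x _ j'' (a + b) hx0 hx1 hj hT0 (by push_cast; linarith) hL0]
  push_cast
  have hd1 : (0:ℝ) < (1 - x) * ((1 - x) * (a : ℝ) + (1 + x) * ((a : ℝ) + (b : ℝ)) - ((b : ℝ) * κ + (a : ℝ) * g)) := by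
    apply mul_pos (sub_pos.2 hx1); nlinarith [mul_nonneg hx0.le (by linarith : (0:ℝ) ≤ (a : ℝ) + (b : ℝ))]
  have hd0 : (0:ℝ) < (1 - x) * ((1 + x) * ((a : ℝ) + (b : ℝ)) - ((b : ℝ) * κ + (a : ℝ) * g)) := by
    apply mul_pos (sub_pos.2 hx1); nlinarith [mul_nonneg hx0.le (by linarith : (0:ℝ) ≤ (a : ℝ) + (b : ℝ))]
  have hn1 : (0:ℝ) ≤ x ^ 2 * (b : ℝ) + (1 - x) * ((b : ℝ) * κ + (a : ℝ) * g - 2 * (a : ℝ)) := by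
    nlinarith [mul_nonneg (pow_nonneg hx0.le 2) hb0.le, mul_nonneg (sub_nonneg.2 hx1.le) (sub_nonneg.2 h2a.le)]
  have key := LightTwoBlobCert.poly_A4 x κ g a b hb0.le hx0.le (by linarith) hk0.le (by linarith) (by linarith) (by linarith) (by linarith [hgam.le]) (by linarith) ha0.le (by linarith [hTb]) (by linarith [h2a]) (by linarith [hL0n]) (by linarith [hT0.le]) (by linarith [hd1.le]) (by linarith [hd0.le]) (by linarith [hsT]) (by linarith [hn1])
  rw [sub_zero, div_mul_eq_mul_div, div_mul_eq_mul_div, div_add_div _ _ hd1.ne' hd0.ne', div_le_iff₀ (mul_pos hd1 hd0)]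
  linarith [mul_nonneg (sub_nonneg.2 hx1.le) (mul_nonneg (sub_nonneg.2 hx1.le) (key))]

/-- **top inequality, cell A5** (c>=b, (0,s) heavy). [this work] -/
theorem top_A5 (x κ g : ℝ) (a b j'' : ℕ) (hx0 : 0 < x) (hx1 : x < 1) (hk0 : 0 < κ) (hkx : κ < x) (hxg : x ≤ g)
    (hg1 : g ≤ 1) (ha : 1 ≤ a) (hb : 1 ≤ b) (hj : a + b ≤ j'') (h2a : 2 * (a : ℝ) < (b : ℝ) * κ + (a : ℝ) * g)
    (hTb : (b : ℝ) ≤ ((b : ℝ) * κ + (a : ℝ) * g)) (hH0 : x * ((a + b : ℕ) : ℝ) ≤ ((b : ℝ) * κ + (a : ℝ) * g)) :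
    usage x ((b : ℝ) * κ + (a : ℝ) * g) j'' a (a + b) * (g * (1 - (x ^ 2 + (1 - x) * κ)))
      + usage x ((b : ℝ) * κ + (a : ℝ) * g) j'' 0 (a + b) * ((1 - g) * (1 - (x ^ 2 + (1 - x) * κ)) - 0)
      ≤ g * (x ^ 2 + (1 - x) * κ) := by
  have ha0 : (0 : ℝ) < (a : ℝ) := by exact_mod_cast Nat.lt_of_lt_of_le Nat.zero_lt_one ha
  have hb0 : (0 : ℝ) < (b : ℝ) := by exact_mod_cast Nat.lt_of_lt_of_le Nat.zero_lt_one hb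
  have hg0 : 0 < g := lt_of_lt_of_le hx0 hxg
  have hgam : 0 < x ^ 2 + (1 - x) * κ := by nlinarith [mul_pos (sub_pos.2 hx1) hk0, pow_pos hx0 2]
  have hgam1 : x ^ 2 + (1 - x) * κ < 1 := by nlinarith [mul_lt_mul_of_pos_left hkx (sub_pos.2 hx1)]
  have hT0 : 0 < (b : ℝ) * κ + (a : ℝ) * g := by nlinarith [mul_pos hb0 hk0, mul_pos ha0 hg0]
  have hsT : (b : ℝ) * κ + (a : ℝ) * g < (b : ℝ) + (a : ℝ) := by
    nlinarith [mul_pos hb0 (sub_pos.2 (hkx.trans hx1)), mul_nonneg ha0.le (sub_nonneg.2 hg1)]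
  have hL1n : (b : ℝ) * κ + (a : ℝ) * g - 2 * (a : ℝ) ≤ x * (b : ℝ) := by
    nlinarith [mul_le_mul_of_nonneg_left hkx.le hb0.le, mul_nonneg ha0.le (by linarith : (0:ℝ) ≤ 2 - g)]
  have hL1 : (b : ℝ) * κ + (a : ℝ) * g - 2 * (a : ℝ) ≤ x * (((a + b : ℕ) : ℝ) - (a : ℝ)) := by push_cast; linarith
  have hH0n : x * ((a : ℝ) + (b : ℝ)) ≤ (b : ℝ) * κ + (a : ℝ) * g := by have h' := hH0; push_cast at h'; linarith
  rw [usage_eq_light' x _ j'' a (a + b) hx0 hx1 hj h2a (by push_cast; linarith) hL1,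
    usage0_eq_heavy x _ j'' (a + b) hx0 hx1 hj hT0 (by push_cast; linarith) hH0]
  push_cast
  have hd1 : (0:ℝ) < (1 - x) * ((1 - x) * (a : ℝ) + (1 + x) * ((a : ℝ) + (b : ℝ)) - ((b : ℝ) * κ + (a : ℝ) * g)) := by
    apply mul_pos (sub_pos.2 hx1); nlinarith [mul_nonneg hx0.le (by linarith : (0:ℝ) ≤ (a : ℝ) + (b : ℝ))]
  have hd0 : (0:ℝ) < ((a : ℝ) + (b : ℝ)) - ((b : ℝ) * κ + (a : ℝ) * g) := by linarith
  have hn1 : (0:ℝ) ≤ x ^ 2 * (b : ℝ) + (1 - x) * ((b : ℝ) * κ + (a : ℝ) * g - 2 * (a : ℝ)) := by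
    nlinarith [mul_nonneg (pow_nonneg hx0.le 2) hb0.le, mul_nonneg (sub_nonneg.2 hx1.le) (sub_nonneg.2 h2a.le)]
  have key := LightTwoBlobCert.poly_A5 x κ g a b hb0.le hx0.le (by linarith) hk0.le (by linarith) (by linarith) (by linarith) (by linarith [hgam.le]) (by linarith) ha0.le (by linarith [hTb]) (by linarith [h2a]) (by linarith [hH0n]) (by linarith [hT0.le]) (by linarith [hd1.le]) (by linarith [hsT]) (by linarith [hn1])
  rw [sub_zero, div_mul_eq_mul_div, div_mul_eq_mul_div, div_add_div _ _ hd1.ne' hd0.ne', div_le_iff₀ (mul_pos hd1 hd0)]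
  linarith [mul_nonneg (sub_nonneg.2 hx1.le) (key)]

end LawDec

end Quant

end Summit.CriticalPhenomena.PercolationContinuityZ3.Theorems
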